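import Mathlib
import HarnessLib
import Summits.HubbardSuperconductivity.HubbardSuperconductivity.Theorems.KLProgrammeKLRegimeFlowReadScaleZeroSecondOrderKernel
import Literature.MathematicalPhysics.QuantumLattice.HubbardMatsubaraShellSums
import Literature.MathematicalPhysics.QuantumLattice.MatsubaraTruncationRemainder

/-!
# Route `KLProgramme`, crux K3 — gen-8 ENGINE-FLOW child (stmt-HubbardSuperconductivity-20437 `KLRegimeEngineV17F2`), stub (C) at `n = 0`,
# located item #22a «(C)-SCALE0-PT2»: THE SCALE-`0` TADPOLE IS `O(1)` UNIFORMLY IN `β, L, M` — `|t₀| ≤ 4`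

Seat hubbard-kl-k3c5-p1 (g13; owner of #22a).  The tadpole `t₀ = −Σ_{(i,k⃗)} (βL²)^{−2}·Ψ⁰((i,k⃗),σ)` of π1 (`contr_scaleZeroGridCov_samePoint`, p610302)
enters #22a twice: as the first-order ON-SITE value of the split piece `W_a` (the door's `hBon` row, `v·|U|`) and, squared, in the Hartree chain's
coefficient `c = (Uβ/4M)²t₀²` (the alias constants of π2c-iii, p615543).  A termwise bound is `O(log M)`; the `±ω` PAIRING makes it `O(1)`:
`Ψ⁰ = βL²·w(ω²+e²)/(−iω+e)` with `w ∈ [0,1]` EVEN in `ω`, so `Σ_ω` over the symmetric Matsubara set is `βL²·Σ_{n<M} w_n·2e/(ν_n²+e²)`, `ν_n = (2n+1)π/β`,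
and the Lorentzian sum is `≤ 4β` uniformly (`§1`: low frequencies `ν_n ≤ |e|` counted, high ones by `Σ 1/(2n+1)²` telescoping —
`Literature.….sum_Ico_one_div_odd_sq_le`).  Hence `|t₀| ≤ (βL²)^{−2}·L²·βL²·4β/β… = 4`.

* §1 `sum_range_one_div_odd_sq_le_five_fourths`, **`sum_range_lorentzian_le`** (`Σ_{n<M} 2a/(ν_n²+a²) ≤ 4β`, `a ≥ 0`);
* §2 `uvSymbolFn_add_uvSymbolFn_neg_freq` (the pair), **`norm_sum_matsubara_uvSymbolFn_le`** (`‖Σ_i Ψ̂(e,ω_i)‖ ≤ |c|·4β`);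
* §3 **`norm_scaleZero_tadpole_le_four`** — `‖Σ_{k} (βL²)^{−2}Ψ⁰(k,σ)‖ ≤ 4` (`0 < β`).

Proofs only; no definitions; nothing asserts any stub of 20437, K3 or superconductivity.
References: BGM 2006 §2.1 (2.3)–(2.6), §2.2 (2.14) [cite: BenfattoGiulianiMastropietro2006]; Pedra–Salmhofer 2008 §5 [cite: PedraSalmhofer2008].
-/

noncomputable section

namespace Summit.HubbardSuperconductivity.HubbardSuperconductivity.Theorems.KLRegimeSplit

set_option linter.dupNamespace false -- summit = problem name (single-conjunct summit), D-0017

open Real Finset Complex Literature.MathematicalPhysics.QuantumLattice Literature.Probability.LatticeModels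
open Summit.HubbardSuperconductivity.HubbardSuperconductivity.Theorems.EngineV8

/-! ## §1 The Lorentzian Matsubara sum is `O(β)` -/

/-- `Σ_{n<M} 1/(2n+1)² ≤ 5/4` (`1 + Σ_{n≥1} ≤ 1 + 1/4`). -/
theorem sum_range_one_div_odd_sq_le_five_fourths (M : ℕ) : ∑ n ∈ range M, 1 / ((2 * (n : ℝ) + 1) ^ 2) ≤ 5 / 4 := by
  rcases Nat.eq_zero_or_pos M with hM | hM
  · subst hM; norm_num
  · rw [Finset.range_eq_Ico, Finset.sum_eq_sum_Ico_succ_bot hM]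
    have h1 := sum_Ico_one_div_odd_sq_le (M := 1) (M'' := M) le_rfl hM
    norm_num at h1 ⊢
    linarith

/-- **`Σ_{n<M} 2a/(ν_n² + a²) ≤ 4β`** for `a ≥ 0`, `ν_n = (2n+1)π/β`, uniformly in `M`. -/
theorem sum_range_lorentzian_le {β : ℝ} (hβ : 0 < β) {a : ℝ} (ha : 0 ≤ a) (M : ℕ) :
    ∑ n ∈ range M, 2 * a / (((2 * (n : ℝ) + 1) * π / β) ^ 2 + a ^ 2) ≤ 4 * β := by
  have hν : ∀ n : ℕ, 0 < (2 * (n : ℝ) + 1) * π / β := fun n => by positivity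
  have hterm_sq : ∀ n : ℕ, 2 * a / (((2 * (n : ℝ) + 1) * π / β) ^ 2 + a ^ 2) ≤ (2 * a * β ^ 2 / π ^ 2) * (1 / (2 * (n : ℝ) + 1) ^ 2) := by
    intro n
    have h1 : 2 * a / (((2 * (n : ℝ) + 1) * π / β) ^ 2 + a ^ 2) ≤ 2 * a / (((2 * (n : ℝ) + 1) * π / β) ^ 2) :=
      div_le_div_of_nonneg_left (by positivity) (by positivity) (by nlinarith [sq_nonneg a])
    refine h1.trans (le_of_eq ?_)
    field_simp
  have hnonneg : ∀ n : ℕ, 0 ≤ 2 * a / (((2 * (n : ℝ) + 1) * π / β) ^ 2 + a ^ 2) := fun n => by positivity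
  by_cases hsmall : a * β ≤ 3 * π
  · -- every frequency treated as `high`: `Σ ≤ (2aβ²/π²)·(5/4) ≤ (6β/π)(5/4) ≤ 4β`
    calc ∑ n ∈ range M, 2 * a / (((2 * (n : ℝ) + 1) * π / β) ^ 2 + a ^ 2)
        ≤ ∑ n ∈ range M, (2 * a * β ^ 2 / π ^ 2) * (1 / (2 * (n : ℝ) + 1) ^ 2) := Finset.sum_le_sum fun n _ => hterm_sq n
      _ = (2 * a * β ^ 2 / π ^ 2) * ∑ n ∈ range M, 1 / (2 * (n : ℝ) + 1) ^ 2 := by rw [Finset.mul_sum]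
      _ ≤ (2 * a * β ^ 2 / π ^ 2) * (5 / 4) :=
          mul_le_mul_of_nonneg_left (sum_range_one_div_odd_sq_le_five_fourths M) (by positivity)
      _ ≤ 4 * β := by
          have hπ3 : (3 : ℝ) < π := Real.pi_gt_three
          have h2 : 2 * a * β ^ 2 / π ^ 2 ≤ 6 * β / π := by
            rw [div_le_div_iff₀ (by positivity) (by positivity)]
            calc 2 * a * β ^ 2 * π = (a * β) * (2 * β * π) := by ring
              _ ≤ (3 * π) * (2 * β * π) := mul_le_mul_of_nonneg_right hsmall (by positivity)
              _ = 6 * β * π ^ 2 := by ring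
          have h3 : 6 * β / π ≤ 2 * β := by
            rw [div_le_iff₀ Real.pi_pos]; nlinarith
          nlinarith [h2, h3, hβ]
  · push Not at hsmall
    have ha0 : 0 < a := by
      by_contra h
      have : a = 0 := le_antisymm (not_lt.1 h) ha
      rw [this, zero_mul] at hsmall
      linarith [Real.pi_pos]
    -- the threshold `m₀ = (aβ/π − 1)/2 > 1`
    set m₀ : ℝ := (a * β / π - 1) / 2 with hm₀
    have haβπ : 3 < a * β / π := by rw [lt_div_iff₀ Real.pi_pos]; linarith
    have hm₀1 : 1 < m₀ := by rw [hm₀]; linarith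
    have hm₀3 : a * β / π ≤ 3 * m₀ := by rw [hm₀]; linarith
    -- split the range at the predicate `ν_n ≤ a`
    rw [← Finset.sum_filter_add_sum_filter_not (range M) (fun n : ℕ => (2 * (n : ℝ) + 1) * π / β ≤ a)]
    -- LOW part
    have hlow : ∑ n ∈ (range M).filter (fun n : ℕ => (2 * (n : ℝ) + 1) * π / β ≤ a),
        2 * a / (((2 * (n : ℝ) + 1) * π / β) ^ 2 + a ^ 2) ≤ 2 * β := by
      set K : ℕ := ⌊m₀⌋₊ + 1 with hK
      have hsub : (range M).filter (fun n : ℕ => (2 * (n : ℝ) + 1) * π / β ≤ a) ⊆ range K := by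
        intro n hn
        rw [Finset.mem_filter] at hn
        rw [Finset.mem_range, hK]
        have hle : (n : ℝ) ≤ m₀ := by
          rw [hm₀]
          have := hn.2
          rw [div_le_iff₀ hβ] at this
          have h' : (2 * (n : ℝ) + 1) ≤ a * β / π := by rw [le_div_iff₀ Real.pi_pos]; linarith
          linarith
        have := Nat.le_floor hle
        omega
      have hK' : (K : ℝ) ≤ m₀ + 1 := by
        rw [hK]; push_cast
        linarith [Nat.floor_le (show (0 : ℝ) ≤ m₀ by linarith)]
      calc ∑ n ∈ (range M).filter (fun n : ℕ => (2 * (n : ℝ) + 1) * π / β ≤ a), 2 * a / (((2 * (n : ℝ) + 1) * π / β) ^ 2 + a ^ 2)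
          ≤ ∑ n ∈ (range M).filter (fun n : ℕ => (2 * (n : ℝ) + 1) * π / β ≤ a), 2 / a := by
            refine Finset.sum_le_sum fun n _ => ?_
            rw [div_le_div_iff₀ (by positivity) ha0]
            nlinarith [sq_nonneg ((2 * (n : ℝ) + 1) * π / β), ha0]
        _ ≤ ∑ _n ∈ range K, 2 / a := Finset.sum_le_sum_of_subset_of_nonneg hsub fun _ _ _ => by positivity
        _ = (K : ℝ) * (2 / a) := by rw [Finset.sum_const, Finset.card_range, nsmul_eq_mul]
        _ ≤ (m₀ + 1) * (2 / a) := mul_le_mul_of_nonneg_right hK' (by positivity)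
        _ ≤ 2 * β := by
            -- `(m₀+1)·(2/a) = (aβ/π + 1)/a = β/π + 1/a ≤ β/π + β/(3π) ≤ 2β`
            rw [hm₀]
            have h1a : 1 / a ≤ β / (3 * π) := by
              rw [div_le_div_iff₀ ha0 (by positivity)]
              have : 3 * π < a * β := hsmall
              linarith
            have hπ3 : (3 : ℝ) < π := Real.pi_gt_three
            have heq : ((a * β / π - 1) / 2 + 1) * (2 / a) = β / π + 1 / a := by field_simp; ring
            rw [heq]
            have hb1 : β / π ≤ β / 3 := div_le_div_of_nonneg_left hβ.le (by norm_num) hπ3.le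
            have hb2 : β / (3 * π) ≤ β / 9 := div_le_div_of_nonneg_left hβ.le (by norm_num) (by nlinarith)
            linarith
    -- HIGH part
    have hhigh : ∑ n ∈ (range M).filter (fun n : ℕ => ¬ (2 * (n : ℝ) + 1) * π / β ≤ a),
        2 * a / (((2 * (n : ℝ) + 1) * π / β) ^ 2 + a ^ 2) ≤ 2 * β := by
      set N₁ : ℕ := ⌊m₀⌋₊ + 1 with hN₁
      have hN₁1 : 1 ≤ N₁ := by rw [hN₁]; omega
      have hN₁m : m₀ < (N₁ : ℝ) := by rw [hN₁]; push_cast; exact Nat.lt_floor_add_one m₀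
      have hsub : (range M).filter (fun n : ℕ => ¬ (2 * (n : ℝ) + 1) * π / β ≤ a) ⊆ Ico N₁ M := by
        intro n hn
        rw [Finset.mem_filter, Finset.mem_range, not_le] at hn
        rw [Finset.mem_Ico]
        refine ⟨?_, hn.1⟩
        have hgt : m₀ < (n : ℝ) := by
          rw [hm₀]
          have := hn.2
          rw [lt_div_iff₀ hβ] at this
          have h' : a * β / π < 2 * (n : ℝ) + 1 := by rw [div_lt_iff₀ Real.pi_pos]; linarith
          linarith
        rw [hN₁]
        have : ⌊m₀⌋₊ < n := by
          by_contra hc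
          push Not at hc
          have := (Nat.floor_le (show (0 : ℝ) ≤ m₀ by linarith)).trans' (show (n : ℝ) ≤ ⌊m₀⌋₊ by exact_mod_cast hc)
          linarith
        omega
      by_cases hNM : N₁ ≤ M
      · calc ∑ n ∈ (range M).filter (fun n : ℕ => ¬ (2 * (n : ℝ) + 1) * π / β ≤ a), 2 * a / (((2 * (n : ℝ) + 1) * π / β) ^ 2 + a ^ 2)
            ≤ ∑ n ∈ Ico N₁ M, 2 * a / (((2 * (n : ℝ) + 1) * π / β) ^ 2 + a ^ 2) :=
              Finset.sum_le_sum_of_subset_of_nonneg hsub fun n _ _ => hnonneg n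
          _ ≤ ∑ n ∈ Ico N₁ M, (2 * a * β ^ 2 / π ^ 2) * (1 / (2 * (n : ℝ) + 1) ^ 2) := Finset.sum_le_sum fun n _ => hterm_sq n
          _ = (2 * a * β ^ 2 / π ^ 2) * ∑ n ∈ Ico N₁ M, 1 / (2 * (n : ℝ) + 1) ^ 2 := by rw [Finset.mul_sum]
          _ ≤ (2 * a * β ^ 2 / π ^ 2) * (1 / (4 * (N₁ : ℝ))) :=
              mul_le_mul_of_nonneg_left (sum_Ico_one_div_odd_sq_le hN₁1 hNM) (by positivity)
          _ ≤ (2 * a * β ^ 2 / π ^ 2) * (1 / (4 * m₀)) := by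
              refine mul_le_mul_of_nonneg_left ?_ (by positivity)
              exact div_le_div_of_nonneg_left (by norm_num) (by positivity) (by linarith)
          _ ≤ 2 * β := by
              -- `= aβ²/(2π²m₀)`, `1/m₀ ≤ 3π/(aβ)` ⇒ `≤ 3β/(2π) ≤ 2β`
              have hm₀pos : 0 < m₀ := by linarith
              have hinv : a * β / m₀ ≤ 3 * π := by
                rw [div_le_iff₀ hm₀pos]
                have := hm₀3
                rw [div_le_iff₀ Real.pi_pos] at this
                linarith
              have heq : (2 * a * β ^ 2 / π ^ 2) * (1 / (4 * m₀)) = (a * β / m₀) * (β / (2 * π ^ 2)) := by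
                field_simp
                norm_num
              rw [heq]
              have hπ3 : (3 : ℝ) < π := Real.pi_gt_three
              calc (a * β / m₀) * (β / (2 * π ^ 2)) ≤ (3 * π) * (β / (2 * π ^ 2)) :=
                    mul_le_mul_of_nonneg_right hinv (by positivity)
                _ = 3 * β / (2 * π) := by field_simp
                _ ≤ 2 * β := by rw [div_le_iff₀ (by positivity)]; nlinarith
      · push Not at hNM
        have hempty : Ico N₁ M = ∅ := Finset.Ico_eq_empty (by omega)
        have hzero : ∑ n ∈ (range M).filter (fun n : ℕ => ¬ (2 * (n : ℝ) + 1) * π / β ≤ a),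
            2 * a / (((2 * (n : ℝ) + 1) * π / β) ^ 2 + a ^ 2) = 0 := by
          have : (range M).filter (fun n : ℕ => ¬ (2 * (n : ℝ) + 1) * π / β ≤ a) = ∅ :=
            Finset.subset_empty.1 (hempty ▸ hsub)
          rw [this, Finset.sum_empty]
        rw [hzero]; positivity
    linarith

/-! ## §2 The paired Matsubara sum of the UV symbol -/

/-- **The `±ω` pair of the UV symbol**: `Ψ̂(e,ν) + Ψ̂(e,−ν) = w(ν²+e²)·c·2e/(ν²+e²)` (`ν ≠ 0`), a REAL number. -/
theorem uvSymbolFn_add_uvSymbolFn_neg_freq (c Λ e : ℝ) {ν : ℝ} (hν : ν ≠ 0) :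
    uvSymbolFn c Λ e ν + uvSymbolFn c Λ e (-ν) = ((uvWeightFn Λ e ν * (c * (2 * e / (ν ^ 2 + e ^ 2))) : ℝ) : ℂ) := by
  have hw : uvWeightFn Λ e (-ν) = uvWeightFn Λ e ν := by simp [uvWeightFn]
  rw [uvSymbolFn, uvSymbolFn, hw, resolventFn, resolventFn]
  push_cast
  simp only [add_zero]
  have hν2 : 0 < ν ^ 2 := lt_of_le_of_ne (sq_nonneg ν) (Ne.symm (pow_ne_zero 2 hν))
  have hD : ((ν : ℂ) ^ 2 + (e : ℂ) ^ 2) = (-I * ν + e) * (I * ν + e) := by ring_nf; rw [I_sq]; ring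
  have h3 : ((ν : ℂ) ^ 2 + (e : ℂ) ^ 2) ≠ 0 := by
    rw [← ofReal_pow, ← ofReal_pow, ← ofReal_add]
    exact ofReal_ne_zero.2 (add_pos_of_pos_of_nonneg hν2 (sq_nonneg e)).ne'
  have h1 : (-I * (ν : ℂ) + e) ≠ 0 := fun h0 => h3 (by rw [hD, h0, zero_mul])
  have h2 : (I * (ν : ℂ) + e) ≠ 0 := fun h0 => h3 (by rw [hD, h0, mul_zero])
  rw [show -I * -(ν : ℂ) + e = I * ν + e by ring, ← mul_add, div_add_div _ _ h1 h2, ← hD]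
  conv_lhs => rw [← mul_div_assoc]
  conv_rhs => rw [← mul_div_assoc, ← mul_div_assoc]
  rw [div_left_inj' h3]
  ring

/-- **`‖Σ_{i} Ψ̂(e, ω_i)‖ ≤ |c|·4β`** over the symmetric truncated Matsubara set `MatsubaraIdx M` (`0 < β`), uniformly in `M`, `e`, `Λ`. -/
theorem norm_sum_matsubara_uvSymbolFn_le {β : ℝ} (hβ : 0 < β) (c Λ e : ℝ) (M : ℕ) :
    ‖∑ i : MatsubaraIdx M, uvSymbolFn c Λ e (matsubaraFreq β M i)‖ ≤ |c| * (4 * β) := by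
  rw [sum_matsubaraIdx_freq_eq_sum_range β M (fun ω => uvSymbolFn c Λ e ω), ← Finset.sum_add_distrib]
  have hν : ∀ n : ℕ, ((2 * (n : ℝ) + 1) * π / β) ≠ 0 := fun n => by positivity
  have hpair : ∀ n : ℕ, uvSymbolFn c Λ e ((2 * n + 1) * π / β) + uvSymbolFn c Λ e (-((2 * n + 1) * π / β)) =
      ((uvWeightFn Λ e ((2 * (n : ℝ) + 1) * π / β) * (c * (2 * e / (((2 * (n : ℝ) + 1) * π / β) ^ 2 + e ^ 2))) : ℝ) : ℂ) :=
    fun n => uvSymbolFn_add_uvSymbolFn_neg_freq c Λ e (hν n)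
  simp_rw [hpair]
  rw [← Complex.ofReal_sum, Complex.norm_real, Real.norm_eq_abs]
  refine (Finset.abs_sum_le_sum_abs _ _).trans ?_
  have hw : ∀ n : ℕ, |uvWeightFn Λ e ((2 * (n : ℝ) + 1) * π / β)| ≤ 1 := fun n => abs_uvWeightFn_le_one _ _ _
  calc ∑ n ∈ range M, |uvWeightFn Λ e ((2 * (n : ℝ) + 1) * π / β) * (c * (2 * e / (((2 * (n : ℝ) + 1) * π / β) ^ 2 + e ^ 2)))|
      ≤ ∑ n ∈ range M, |c| * (2 * |e| / (((2 * (n : ℝ) + 1) * π / β) ^ 2 + |e| ^ 2)) := by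
        refine Finset.sum_le_sum fun n _ => ?_
        rw [abs_mul, abs_mul, abs_div, abs_mul, abs_two, sq_abs, abs_of_pos (by positivity : (0 : ℝ) < ((2 * (n : ℝ) + 1) * π / β) ^ 2 + e ^ 2)]
        calc |uvWeightFn Λ e ((2 * (n : ℝ) + 1) * π / β)| * (|c| * (2 * |e| / (((2 * (n : ℝ) + 1) * π / β) ^ 2 + e ^ 2)))
            ≤ 1 * (|c| * (2 * |e| / (((2 * (n : ℝ) + 1) * π / β) ^ 2 + e ^ 2))) :=
              mul_le_mul_of_nonneg_right (hw n) (by positivity)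
          _ = _ := one_mul _
    _ = |c| * ∑ n ∈ range M, 2 * |e| / (((2 * (n : ℝ) + 1) * π / β) ^ 2 + |e| ^ 2) := by rw [Finset.mul_sum]
    _ ≤ |c| * (4 * β) := mul_le_mul_of_nonneg_left (sum_range_lorentzian_le hβ (abs_nonneg e) M) (abs_nonneg c)

/-! ## §3 The scale-`0` tadpole -/

variable {L M : ℕ} [NeZero L]

/-- **THE SCALE-`0` TADPOLE IS `O(1)`**: `‖Σ_{k} (βL²)^{−2}·Ψ⁰(k,σ)‖ ≤ 4` (`0 < β`), uniformly in `β, L, M, μ`; so `|t₀| ≤ 4` for the tadpole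
`t₀ = −Σ_k (βL²)^{−2}Ψ⁰(k,0)` of `contr_scaleZeroGridCov_samePoint`. -/
theorem norm_scaleZero_tadpole_le_four {β : ℝ} (hβ : 0 < β) (μ : ℝ) (σ : Fin 2) :
    ‖∑ k : FreqMomentum L M, ((1 / (β * (L : ℝ) ^ 2) : ℝ) : ℂ) ^ 2 * uvSymbolCT L M β μ 0 klE0 (k, σ)‖ ≤ 4 := by
  have hL : (0 : ℝ) < (L : ℝ) := by have := NeZero.ne L; positivity
  have hβL : 0 < β * (L : ℝ) ^ 2 := by positivity
  rw [← Finset.mul_sum, norm_mul, Fintype.sum_prod_type, Finset.sum_comm]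
  simp_rw [uvSymbolCT_eq_uvSymbolFn hβ μ 0 klE0]
  have hrow : ∀ kv : TorusSite 2 L, ‖∑ i : MatsubaraIdx M, uvSymbolFn (β * (L : ℝ) ^ 2) klE0 (nambuXiCT L μ 0 kv) (matsubaraFreq β M i)‖ ≤
      |β * (L : ℝ) ^ 2| * (4 * β) := fun kv => norm_sum_matsubara_uvSymbolFn_le hβ _ _ _ M
  have hcard : (Fintype.card (TorusSite 2 L) : ℝ) = (L : ℝ) ^ 2 := by
    have : Fintype.card (TorusSite 2 L) = L ^ 2 := by simp [TorusSite, ZMod.card]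
    rw [this]; push_cast; ring
  have hsum : ‖∑ kv : TorusSite 2 L, ∑ i : MatsubaraIdx M,
      uvSymbolFn (β * (L : ℝ) ^ 2) klE0 (nambuXiCT L μ 0 kv) (matsubaraFreq β M i)‖ ≤ (L : ℝ) ^ 2 * (|β * (L : ℝ) ^ 2| * (4 * β)) := by
    refine (norm_sum_le _ _).trans ((Finset.sum_le_sum fun kv _ => hrow kv).trans (le_of_eq ?_))
    rw [Finset.sum_const, Finset.card_univ, nsmul_eq_mul, hcard]
  have hn : ‖(((1 / (β * (L : ℝ) ^ 2) : ℝ) : ℂ) ^ 2)‖ = (1 / (β * (L : ℝ) ^ 2)) ^ 2 := by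
    rw [norm_pow, Complex.norm_real, Real.norm_eq_abs, abs_of_pos (by positivity)]
  rw [hn]
  calc (1 / (β * (L : ℝ) ^ 2)) ^ 2 * ‖∑ kv : TorusSite 2 L, ∑ i : MatsubaraIdx M,
          uvSymbolFn (β * (L : ℝ) ^ 2) klE0 (nambuXiCT L μ 0 kv) (matsubaraFreq β M i)‖
      ≤ (1 / (β * (L : ℝ) ^ 2)) ^ 2 * ((L : ℝ) ^ 2 * (|β * (L : ℝ) ^ 2| * (4 * β))) :=
        mul_le_mul_of_nonneg_left hsum (by positivity)
    _ = 4 := by rw [abs_of_pos hβL]; field_simp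

end Summit.HubbardSuperconductivity.HubbardSuperconductivity.Theorems.KLRegimeSplit

end
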